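import Mathlib
import Literature.AlgebraicGeometry.Resolution.CobordantGame
import Literature.AlgebraicGeometry.Resolution.CobordantChartCoefficients
import Literature.AlgebraicGeometry.Resolution.CobordantChartPlaneSlice
import Literature.AlgebraicGeometry.Resolution.CobordantTupleGame
import Summits.ResolutionOfSingularities.ResolutionOfSingularities.Theorems.WeightedInvariantLocalWeightedDropMonicCurveBlowup

/-!
# `WeightedInvariant.LocalWeightedDrop`, line `hasse-ridge-face-selection`: a worked example of the curve brick —
# the cuspidal cylinder `y² + x₁³` is won in ONE move, in every characteristic

Crux item stmt-ResolutionOfSingularities-8899 `LocalWeightedDrop` (route `ResolutionOfSingularities/WeightedInvariant`),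
serving the door `WeightedConstruction` stmt-ResolutionOfSingularities-0571.  [OURS · L1 W4.3, chain w43, stub worker 3: a test
of the brick `won_monic_of_curveBlowup` on the position space of the wild pieces S2/S3.  Not a statement of any manuscript.]

`cuspidalCylinder_won`: over every field `k` of every characteristic `p`, the monic double point `y² + x₁³ ∈ k[[x₁, x₂, y]]`
(in characteristic `2` the purely inseparable surface `y² = x₁³`) is won in the local weighted resolution game by ONE move, the
blow-up of the permissible curve `V(x₁, y)`: `A = (x₁³, 0) = (x₁² · x₁, x₁ · 0)`, and at every exceptional point with
`c₁ ≠ 0` the slice is `y² + c₁³ s`, which has a linear term — no singular successor exists, so the hypothesis of the brick is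
vacuous.  (A point blow-up instead would produce the position `y² + s x₁'³` of HIGHER order of `A₀`: choosing the curve is what a
rank has to do here.)
-/

set_option linter.dupNamespace false -- mandated namespace of this single-conjunct summit

namespace Summit.ResolutionOfSingularities.ResolutionOfSingularities.Theorems

open Literature.AlgebraicGeometry.Resolution
open Literature.AlgebraicGeometry.Resolution.CobordantGame

open MvPowerSeries in
/-- THE CUSPIDAL CYLINDER `y² + x₁³ ∈ k[[x₁, x₂, y]]` IS WON (every characteristic `p`), by ONE move: the blow-up of the
permissible curve `V(x₁, y)` (`won_monic_of_curveBlowup` with `A = (x₁³, 0) = x₁^{(2,1)} · (x₁, 0)`).  Every slice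
`y² + c₁³ s + …` has a linear term, so Refuter has no singular exceptional point: the hypothesis of the brick is vacuous.
(In characteristic `2` this germ is the purely inseparable `y² = x₁³`; the example shows the landed bricks run.) -/
theorem cuspidalCylinder_won (p : ℕ) (hp : p.Prime) (k : Type) [Field k] [CharP k p] :
    CobordantGame.Won k 3 (MvPowerSeries.X (Fin.last 2) ^ 2 +
      ∑ j : Fin 2, MvPowerSeries.rename (Fin.succAboveEmb (Fin.last 2))
        ((![MvPowerSeries.X 0 ^ 3, 0] : Fin 2 → MvPowerSeries (Fin 2) k) j) * MvPowerSeries.X (Fin.last 2) ^ (j : ℕ)) := by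
  classical
  refine won_monic_of_curveBlowup p hp k 2 2 two_pos 0 (![X 0 ^ 3, 0]) (![X 0, 0]) ?_ ?_ ?_
  · intro j
    fin_cases j
    · simp [pow_succ]
    · simp
  · intro j
    fin_cases j
    · simp [constantCoeff_X]
    · simp
  · intro ci hci hS
    exfalso
    -- the slice is `y² + c₁³ · s`: it has a linear term
    have hchart : subst (CobordantChart.chart (fun l : Fin 2 => if l = 0 then 1 else 0) (fun l : Fin 2 => if l = 0 then ci else 0))
        (X 0 : MvPowerSeries (Fin 2) k) = X 0 * (C ci + X 1) := by
      rw [subst_X (CobordantChart.hasSubst_chart _ _ (fun l hl => by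
        by_cases h : l = 0
        · simp [h] at hl
        · simp [h])), CobordantChart.chart_apply]
      simp
    have hslice : TupleGame.slice (0 : Fin 2) (X 0 * (C ci + X 1) : MvPowerSeries (Fin 3) k) = C ci * X 0 := by
      have hs := CobordantChartPlaneSlice.hasSubst_slice (R := k) (0 : Fin 2)
      unfold TupleGame.slice
      rw [← coe_substAlgHom hs, map_mul, map_add, coe_substAlgHom, subst_X hs, subst_X hs, subst_C]
      simp
      ring
    have hslice0 : TupleGame.slice (0 : Fin 2) (0 : MvPowerSeries (Fin 3) k) = 0 := by
      have hs := CobordantChartPlaneSlice.hasSubst_slice (R := k) (0 : Fin 2)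
      unfold TupleGame.slice
      rw [← coe_substAlgHom hs, map_zero]
    have hsubst0 : subst (CobordantChart.chart (fun l : Fin 2 => if l = 0 then 1 else 0) (fun l : Fin 2 => if l = 0 then ci else 0))
        (0 : MvPowerSeries (Fin 2) k) = 0 := by
      rw [← coe_substAlgHom (CobordantChart.hasSubst_chart _ _ (fun l hl => by
        by_cases h : l = 0
        · simp [h] at hl
        · simp [h])), map_zero]
    have h10 : ¬ ((Finsupp.single (0 : Fin 3) 1 : Fin 3 →₀ ℕ) = Finsupp.single (Fin.last 2) 2) := by
      intro h
      have h' := DFunLike.congr_fun h 0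
      rw [Finsupp.single_eq_same, Finsupp.single_eq_of_ne (by decide)] at h'
      exact one_ne_zero h'
    have hemb0 : (Fin.succAboveEmb (Fin.last 2)) (0 : Fin 2) = 0 := rfl
    have hlin := hS.2.2 0
    rw [Fin.sum_univ_two] at hlin
    simp only [Matrix.cons_val_zero, Matrix.cons_val_one, Fin.val_zero, Fin.val_one, pow_zero, mul_one,
      pow_one, hchart, hslice, hsubst0, hslice0, map_add, map_mul, rename_C, rename_X, hemb0] at hlin
    rw [map_zero, mul_zero, zero_mul, map_zero, add_zero, ← mul_assoc, ← map_mul, coeff_C_mul, coeff_X, if_pos rfl,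
      mul_one, Nat.sub_zero, coeff_X_pow, if_neg h10, zero_add] at hlin
    exact pow_ne_zero 3 hci (by rw [pow_succ, hlin])

end Summit.ResolutionOfSingularities.ResolutionOfSingularities.Theorems
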